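import Summits.NavierStokesRegularity.NavierStokesRegularity.Theorems.EfficiencyFloorRigidExitOrbitClosed
import Summits.NavierStokesRegularity.NavierStokesRegularity.Theorems.EfficiencyFloorRigidExitTangentConeEnstrophy
import HarnessLib

/-!
# Route `EfficiencyFloor`, support `RigidExit` (stmt-25513) on the `ProductionEfficiencyDecay` ladder (stmt-22866):
# BOUNDED-RATE ORBIT TANGENTS ARE INFINITESIMAL SYMMETRIES — the tangent-cone condition holds along representatives at rate `O(τₙ)`

Helper file (`--supports stmt-NavierStokesRegularity-22866`; line `efficiency_floor`), sequel to `…RigidExitTangentCone(Enstrophy)`.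
Those files replaced item (i) ORBIT SELECTION of `RigidExit` by the static condition (TC_Z): pointwise tangents
`h = lim τₙ⁻¹(wₙ − m)` of the normalised-maximiser set at `m` are infinitesimal symmetries. Under clause (a) the `wₙ` near `m` are orbit
points `wₙ = λₙ Rₙ m(λₙ Rₙ⁻¹(· − aₙ))` with `(λₙ, Rₙ, aₙ) → (1, I, 0)` (compactness modulo the group, `…OrbitClosed`, `…ScaleClock`).
This file proves the tangent-cone conclusion whenever the group parameters move at RATE `O(τₙ)` — precisely, whenever the
difference quotients `τₙ⁻¹(λₙ − 1)`, `τₙ⁻¹(Rₙ − I)`, `τₙ⁻¹(Rₙ⁻¹ − I)`, `τₙ⁻¹ aₙ` converge (stated for operator sequences `Cₙ, C'ₙ` with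
`C'ₙ Cₙ = I` and `Cₙ` inner-product preserving, as in `RotatingOrbit.hasDerivAt_movingOrbit`):

* `inv_rate_eq_neg`, `skew_of_isometry_rate` (§1): the limits `Rd = lim τₙ⁻¹(Cₙ − I)`, `Rd' = lim τₙ⁻¹(C'ₙ − I)` satisfy `Rd' = −Rd`
  and `⟪Rd v, w⟫ = −⟪v, Rd w⟫`.
* `tangent_of_boundedRate` (§2): if moreover `τₙ⁻¹(λₙ Cₙ m(λₙ C'ₙ(x − aₙ)) − m(x)) → h(x)` for every `x` (`m` differentiable), then
  `h = (d·∇)m + ((Wx)·∇)m − Wm + c′(m + (x·∇)m)` with `d = −lim τₙ⁻¹aₙ`, `W = −Rd` (skew), `c′ = lim τₙ⁻¹(λₙ − 1)` — the orbit map is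
  differentiable at the identity in the finite-dimensional parameter (`HasFDerivAt.lim`), and its differential along `(l′, Rd, Rd′, ad)` is
  read off the landed chain rule `RotatingOrbit.hasDerivAt_movingOrbit` on the straight path through the identity.

So the EXACT residue of item (i) under clause (a) is the RATE statement: tangent sequences of the maximiser set admit orbit
representatives with parameters at distance `O(τₙ)` from the identity (automatic for a trivial stabiliser; for a profile with a
rotational symmetry axis — the expected colliding-ring maximiser — it is the local section of `E(3)/SO(2)`, the compact-stabiliser
slice). HONEST FRAMING: finite-dimensional calculus; (TC_Z), clause (a), `RigidExit`, `NearMaximiserBoundedAmplification`,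
`LerayFloorGap`, `ProductionEfficiencyDecay` (stmt-22866) and Navier–Stokes regularity stay OPEN; no summit statement is proved.
[folklore]
-/

-- the problem directory repeats the summit name (`NavierStokesRegularity/NavierStokesRegularity`)
set_option linter.dupNamespace false

noncomputable section

open Set Filter MeasureTheory Topology Function
open scoped InnerProductSpace RealInnerProductSpace ENNReal NNReal
open Literature.Analysis.FluidPDE

namespace Summit.NavierStokesRegularity.NavierStokesRegularity.Theorems

namespace RigidExit

namespace TangentCone

open MaximiserSetRigidity.RotatingOrbit OrbitClosed

/-! ## §1 Difference quotients of isometries -/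

/-- A sequence whose `τₙ⁻¹`-quotients converge, with `τₙ → 0`, tends to `0`. [folklore] -/
theorem tendsto_zero_of_rate {F : Type*} [NormedAddCommGroup F] [NormedSpace ℝ F] {τ : ℕ → ℝ} (hτ0 : Tendsto τ atTop (𝓝 0))
    {x : ℕ → F} {L : F} (hx : Tendsto (fun n => (τ n)⁻¹ • x n) atTop (𝓝 L)) (hτ : ∀ n, τ n ≠ 0) :
    Tendsto x atTop (𝓝 0) := by
  have h := hτ0.smul hx
  rw [zero_smul] at h
  refine h.congr fun n => ?_
  rw [smul_smul, mul_inv_cancel₀ (hτ n), one_smul]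

/-- **Directional limit of difference quotients along an approximating sequence.** If `f` has Fréchet derivative `f'` at `x`,
`dₙ → 0` and `cₙ • dₙ → v`, then `cₙ • (f(x + dₙ) − f(x)) → f' v`. [folklore] -/
theorem tendsto_smul_sub_of_hasFDerivAt {E' F' : Type*} [NormedAddCommGroup E'] [NormedSpace ℝ E'] [NormedAddCommGroup F']
    [NormedSpace ℝ F'] {f : E' → F'} {f' : E' →L[ℝ] F'} {x : E'} (hf : HasFDerivAt f f' x) {c : ℕ → ℝ} {d : ℕ → E'} {v : E'}
    (hd : Tendsto d atTop (𝓝 0)) (hcd : Tendsto (fun n => c n • d n) atTop (𝓝 v)) :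
    Tendsto (fun n => c n • (f (x + d n) - f x)) atTop (𝓝 (f' v)) := by
  have h1 : (fun n => f (x + d n) - f x - f' (d n)) =o[atTop] d :=
    (hasFDerivAt_iff_isLittleO_nhds_zero.1 hf).comp_tendsto hd
  have h2 : (fun n => c n • (f (x + d n) - f x - f' (d n))) =o[atTop] (fun n => c n • d n) :=
    (Asymptotics.isBigO_refl c atTop).smul_isLittleO h1
  have h3 : (fun n => c n • d n) =O[atTop] (fun _ => (1 : ℝ)) := hcd.isBigO_one ℝ
  have h4 := h2.trans_isBigO h3
  rw [Asymptotics.isLittleO_one_iff] at h4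
  have h5 : Tendsto (fun n => f' (c n • d n)) atTop (𝓝 (f' v)) := (f'.continuous.tendsto v).comp hcd
  have h6 := h4.add h5
  rw [zero_add] at h6
  refine h6.congr fun n => ?_
  simp only [smul_sub, map_smul]
  abel

/-- Operators `Cₙ` with `τₙ⁻¹(Cₙ − I)` convergent and `τₙ → 0` converge pointwise to the identity. [folklore] -/
theorem tendsto_apply_of_rate {τ : ℕ → ℝ} (hτ : ∀ n, τ n ≠ 0) (hτ0 : Tendsto τ atTop (𝓝 0))
    {C : ℕ → (EuclideanSpace ℝ (Fin 3) →L[ℝ] EuclideanSpace ℝ (Fin 3))} {Rd : EuclideanSpace ℝ (Fin 3) →L[ℝ] EuclideanSpace ℝ (Fin 3)}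
    (hC : Tendsto (fun n => (τ n)⁻¹ • (C n - ContinuousLinearMap.id ℝ (EuclideanSpace ℝ (Fin 3)))) atTop (𝓝 Rd)) (v : EuclideanSpace ℝ (Fin 3)) :
    Tendsto (fun n => C n v) atTop (𝓝 v) := by
  have h0 := tendsto_zero_of_rate (x := fun n => C n - ContinuousLinearMap.id ℝ (EuclideanSpace ℝ (Fin 3))) (L := Rd) hτ0 hC hτ
  have hv : Tendsto (fun _ : ℕ => v) atTop (𝓝 v) := tendsto_const_nhds
  have h1 : Tendsto (fun n => (C n - ContinuousLinearMap.id ℝ (EuclideanSpace ℝ (Fin 3))) v) atTop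
      (𝓝 ((0 : EuclideanSpace ℝ (Fin 3) →L[ℝ] EuclideanSpace ℝ (Fin 3)) v)) := tendsto_clm_apply h0 hv
  rw [zero_apply] at h1
  have h2 := h1.add_const v
  rw [zero_add] at h2
  refine h2.congr fun n => ?_
  simp

/-- **Isometry difference quotients: the inverse quotient is minus the direct one.** If `C'ₙ Cₙ = I`, `τₙ → 0`, `τₙ ≠ 0`,
`τₙ⁻¹(Cₙ − I) → Rd` and `τₙ⁻¹(C'ₙ − I) → Rd'`, then `Rd' = −Rd`. [folklore] -/
theorem inv_rate_eq_neg {τ : ℕ → ℝ} (hτ : ∀ n, τ n ≠ 0) (hτ0 : Tendsto τ atTop (𝓝 0))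
    {C C' : ℕ → (EuclideanSpace ℝ (Fin 3) →L[ℝ] EuclideanSpace ℝ (Fin 3))}
    (hinv : ∀ n v, C' n (C n v) = v) {Rd Rd' : EuclideanSpace ℝ (Fin 3) →L[ℝ] EuclideanSpace ℝ (Fin 3)}
    (hC : Tendsto (fun n => (τ n)⁻¹ • (C n - ContinuousLinearMap.id ℝ (EuclideanSpace ℝ (Fin 3)))) atTop (𝓝 Rd))
    (hC' : Tendsto (fun n => (τ n)⁻¹ • (C' n - ContinuousLinearMap.id ℝ (EuclideanSpace ℝ (Fin 3)))) atTop (𝓝 Rd')) :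
    ∀ v, Rd' v = -Rd v := by
  intro v
  have hCv : Tendsto (fun n => C n v) atTop (𝓝 v) := tendsto_apply_of_rate hτ hτ0 hC v
  -- `τₙ⁻¹(C'ₙ − I)(Cₙ v) + τₙ⁻¹(Cₙ − I) v = 0`
  have hsum : ∀ n, ((τ n)⁻¹ • (C' n - ContinuousLinearMap.id ℝ (EuclideanSpace ℝ (Fin 3)))) (C n v) + ((τ n)⁻¹ • (C n - ContinuousLinearMap.id ℝ (EuclideanSpace ℝ (Fin 3)))) v = 0 := by
    intro n
    have e1 : ((τ n)⁻¹ • (C' n - ContinuousLinearMap.id ℝ (EuclideanSpace ℝ (Fin 3)))) (C n v) = (τ n)⁻¹ • (v - C n v) := by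
      simp [hinv]
    have e2 : ((τ n)⁻¹ • (C n - ContinuousLinearMap.id ℝ (EuclideanSpace ℝ (Fin 3)))) v = (τ n)⁻¹ • (C n v - v) := by simp
    rw [e1, e2, ← smul_add, sub_add_sub_cancel, sub_self, smul_zero]
  have hv : Tendsto (fun _ : ℕ => v) atTop (𝓝 v) := tendsto_const_nhds
  have hlim := (tendsto_clm_apply hC' hCv).add (tendsto_clm_apply hC hv)
  have hzero : Tendsto (fun n => ((τ n)⁻¹ • (C' n - ContinuousLinearMap.id ℝ (EuclideanSpace ℝ (Fin 3)))) (C n v) +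
      ((τ n)⁻¹ • (C n - ContinuousLinearMap.id ℝ (EuclideanSpace ℝ (Fin 3)))) v) atTop (𝓝 0) := by
    simp only [hsum]; exact tendsto_const_nhds
  have := tendsto_nhds_unique hlim hzero
  exact eq_neg_of_add_eq_zero_left this

/-- **Isometry difference quotients are skew.** If `⟪Cₙ v, Cₙ w⟫ = ⟪v, w⟫`, `τₙ → 0`, `τₙ ≠ 0` and `τₙ⁻¹(Cₙ − I) → Rd`, then
`⟪Rd v, w⟫ = −⟪v, Rd w⟫`. [folklore] -/
theorem skew_of_isometry_rate {τ : ℕ → ℝ} (hτ : ∀ n, τ n ≠ 0) (hτ0 : Tendsto τ atTop (𝓝 0))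
    {C : ℕ → (EuclideanSpace ℝ (Fin 3) →L[ℝ] EuclideanSpace ℝ (Fin 3))}
    (hiso : ∀ n (v w : EuclideanSpace ℝ (Fin 3)), ⟪C n v, C n w⟫_ℝ = ⟪v, w⟫_ℝ)
    {Rd : EuclideanSpace ℝ (Fin 3) →L[ℝ] EuclideanSpace ℝ (Fin 3)}
    (hC : Tendsto (fun n => (τ n)⁻¹ • (C n - ContinuousLinearMap.id ℝ (EuclideanSpace ℝ (Fin 3)))) atTop (𝓝 Rd)) :
    ∀ v w : EuclideanSpace ℝ (Fin 3), ⟪Rd v, w⟫_ℝ = -⟪v, Rd w⟫_ℝ := by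
  intro v w
  have hCw : Tendsto (fun n => C n w) atTop (𝓝 w) := tendsto_apply_of_rate hτ hτ0 hC w
  -- `⟪τₙ⁻¹(Cₙ − I) v, Cₙ w⟫ + ⟪v, τₙ⁻¹(Cₙ − I) w⟫ = 0`
  have hsum : ∀ n, ⟪((τ n)⁻¹ • (C n - ContinuousLinearMap.id ℝ (EuclideanSpace ℝ (Fin 3)))) v, C n w⟫_ℝ +
      ⟪v, ((τ n)⁻¹ • (C n - ContinuousLinearMap.id ℝ (EuclideanSpace ℝ (Fin 3)))) w⟫_ℝ = 0 := by
    intro n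
    have e1 : ((τ n)⁻¹ • (C n - ContinuousLinearMap.id ℝ (EuclideanSpace ℝ (Fin 3)))) v = (τ n)⁻¹ • (C n v - v) := by simp
    have e2 : ((τ n)⁻¹ • (C n - ContinuousLinearMap.id ℝ (EuclideanSpace ℝ (Fin 3)))) w = (τ n)⁻¹ • (C n w - w) := by simp
    rw [e1, e2, real_inner_smul_left, real_inner_smul_right, inner_sub_left, inner_sub_right, hiso]
    ring
  have hv : Tendsto (fun _ : ℕ => v) atTop (𝓝 v) := tendsto_const_nhds
  have hw : Tendsto (fun _ : ℕ => w) atTop (𝓝 w) := tendsto_const_nhds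
  have h1 := Filter.Tendsto.inner (𝕜 := ℝ) (tendsto_clm_apply hC hv) hCw
  have h2 := Filter.Tendsto.inner (𝕜 := ℝ) hv (tendsto_clm_apply hC hw)
  have hlim := h1.add h2
  have hzero : Tendsto (fun n => ⟪((τ n)⁻¹ • (C n - ContinuousLinearMap.id ℝ (EuclideanSpace ℝ (Fin 3)))) v, C n w⟫_ℝ +
      ⟪v, ((τ n)⁻¹ • (C n - ContinuousLinearMap.id ℝ (EuclideanSpace ℝ (Fin 3)))) w⟫_ℝ) atTop (𝓝 0) := by
    simp only [hsum]; exact tendsto_const_nhds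
  have := tendsto_nhds_unique hlim hzero
  linarith

/-! ## §2 Bounded-rate orbit tangents are infinitesimal symmetries -/

/-- **The orbit map is differentiable in the parameters** `q = (λ, C, C', a) ↦ λ • C (m (λ • C' (x − a)))`, for differentiable `m`.
[folklore] -/
theorem differentiableAt_orbitParam {m : EuclideanSpace ℝ (Fin 3) → EuclideanSpace ℝ (Fin 3)} (hm : Differentiable ℝ m)
    (x : EuclideanSpace ℝ (Fin 3))
    (q : ℝ × ((EuclideanSpace ℝ (Fin 3) →L[ℝ] EuclideanSpace ℝ (Fin 3)) × ((EuclideanSpace ℝ (Fin 3) →L[ℝ] EuclideanSpace ℝ (Fin 3)) ×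
      EuclideanSpace ℝ (Fin 3)))) :
    DifferentiableAt ℝ (fun q : ℝ × ((EuclideanSpace ℝ (Fin 3) →L[ℝ] EuclideanSpace ℝ (Fin 3)) ×
      ((EuclideanSpace ℝ (Fin 3) →L[ℝ] EuclideanSpace ℝ (Fin 3)) × EuclideanSpace ℝ (Fin 3))) =>
        q.1 • q.2.1 (m (q.1 • q.2.2.1 (x - q.2.2.2)))) q := by
  have h1 : DifferentiableAt ℝ (fun q : ℝ × ((EuclideanSpace ℝ (Fin 3) →L[ℝ] EuclideanSpace ℝ (Fin 3)) ×
      ((EuclideanSpace ℝ (Fin 3) →L[ℝ] EuclideanSpace ℝ (Fin 3)) × EuclideanSpace ℝ (Fin 3))) => q.1) q := differentiableAt_fst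
  have h2 : DifferentiableAt ℝ (fun q : ℝ × ((EuclideanSpace ℝ (Fin 3) →L[ℝ] EuclideanSpace ℝ (Fin 3)) ×
      ((EuclideanSpace ℝ (Fin 3) →L[ℝ] EuclideanSpace ℝ (Fin 3)) × EuclideanSpace ℝ (Fin 3))) => q.2.1) q :=
    differentiableAt_snd.fst
  have h3 : DifferentiableAt ℝ (fun q : ℝ × ((EuclideanSpace ℝ (Fin 3) →L[ℝ] EuclideanSpace ℝ (Fin 3)) ×
      ((EuclideanSpace ℝ (Fin 3) →L[ℝ] EuclideanSpace ℝ (Fin 3)) × EuclideanSpace ℝ (Fin 3))) => q.2.2.1) q :=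
    differentiableAt_snd.snd.fst
  have h4 : DifferentiableAt ℝ (fun q : ℝ × ((EuclideanSpace ℝ (Fin 3) →L[ℝ] EuclideanSpace ℝ (Fin 3)) ×
      ((EuclideanSpace ℝ (Fin 3) →L[ℝ] EuclideanSpace ℝ (Fin 3)) × EuclideanSpace ℝ (Fin 3))) => q.2.2.2) q :=
    differentiableAt_snd.snd.snd
  have hin : DifferentiableAt ℝ (fun q : ℝ × ((EuclideanSpace ℝ (Fin 3) →L[ℝ] EuclideanSpace ℝ (Fin 3)) ×
      ((EuclideanSpace ℝ (Fin 3) →L[ℝ] EuclideanSpace ℝ (Fin 3)) × EuclideanSpace ℝ (Fin 3))) => q.1 • q.2.2.1 (x - q.2.2.2)) q :=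
    h1.smul (h3.clm_apply ((differentiableAt_const x).sub h4))
  have hm' : DifferentiableAt ℝ (fun q : ℝ × ((EuclideanSpace ℝ (Fin 3) →L[ℝ] EuclideanSpace ℝ (Fin 3)) ×
      ((EuclideanSpace ℝ (Fin 3) →L[ℝ] EuclideanSpace ℝ (Fin 3)) × EuclideanSpace ℝ (Fin 3))) =>
        m (q.1 • q.2.2.1 (x - q.2.2.2))) q := (hm _).comp q hin
  exact h1.smul (h2.clm_apply hm')

set_option maxHeartbeats 400000 in
/-- **Bounded-rate orbit tangents are infinitesimal symmetries.** Let `m : ℝ³ → ℝ³` be differentiable, `Cₙ, C'ₙ` operators with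
`C'ₙ Cₙ = I` and `Cₙ` inner-product preserving, `λₙ ∈ ℝ`, `aₙ ∈ ℝ³`, `τₙ ≠ 0`, `τₙ → 0`, with convergent difference quotients
`τₙ⁻¹(λₙ − 1) → l'`, `τₙ⁻¹(Cₙ − I) → Rd`, `τₙ⁻¹(C'ₙ − I) → Rd'`, `τₙ⁻¹ aₙ → ad`. If `τₙ⁻¹(λₙ Cₙ m(λₙ C'ₙ(x − aₙ)) − m(x)) → h(x)` for
every `x`, then `h(x) = Dm(x)d + (Dm(x)(Wx) − W m(x)) + c′(m(x) + Dm(x)x)` with `d = −ad`, `W = −Rd` skew, `c′ = l'`. [folklore] -/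
theorem tangent_of_boundedRate {m : EuclideanSpace ℝ (Fin 3) → EuclideanSpace ℝ (Fin 3)} (hm : Differentiable ℝ m)
    {lam : ℕ → ℝ} {C C' : ℕ → (EuclideanSpace ℝ (Fin 3) →L[ℝ] EuclideanSpace ℝ (Fin 3))} {a : ℕ → EuclideanSpace ℝ (Fin 3)}
    (hinv : ∀ n v, C' n (C n v) = v) (hiso : ∀ n (v w : EuclideanSpace ℝ (Fin 3)), ⟪C n v, C n w⟫_ℝ = ⟪v, w⟫_ℝ)
    {τ : ℕ → ℝ} (hτ : ∀ n, τ n ≠ 0) (hτ0 : Tendsto τ atTop (𝓝 0))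
    {l' : ℝ} {Rd Rd' : EuclideanSpace ℝ (Fin 3) →L[ℝ] EuclideanSpace ℝ (Fin 3)} {ad : EuclideanSpace ℝ (Fin 3)}
    (hl : Tendsto (fun n => (τ n)⁻¹ * (lam n - 1)) atTop (𝓝 l'))
    (hC : Tendsto (fun n => (τ n)⁻¹ • (C n - ContinuousLinearMap.id ℝ (EuclideanSpace ℝ (Fin 3)))) atTop (𝓝 Rd))
    (hC' : Tendsto (fun n => (τ n)⁻¹ • (C' n - ContinuousLinearMap.id ℝ (EuclideanSpace ℝ (Fin 3)))) atTop (𝓝 Rd'))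
    (ha : Tendsto (fun n => (τ n)⁻¹ • a n) atTop (𝓝 ad))
    {h : EuclideanSpace ℝ (Fin 3) → EuclideanSpace ℝ (Fin 3)}
    (hh : ∀ x, Tendsto (fun n => (τ n)⁻¹ • (lam n • C n (m (lam n • C' n (x - a n))) - m x)) atTop (𝓝 (h x))) :
    ∃ (d : EuclideanSpace ℝ (Fin 3)) (W : EuclideanSpace ℝ (Fin 3) →L[ℝ] EuclideanSpace ℝ (Fin 3)) (c' : ℝ),
      (∀ x y : EuclideanSpace ℝ (Fin 3), ⟪W x, y⟫_ℝ = -⟪x, W y⟫_ℝ) ∧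
      ∀ x, h x = fderiv ℝ m x d + (fderiv ℝ m x (W x) - W (m x)) + c' • (m x + fderiv ℝ m x x) := by
  have hneg := inv_rate_eq_neg hτ hτ0 hinv hC hC'
  have hskew := skew_of_isometry_rate hτ hτ0 hiso hC
  refine ⟨-ad, -Rd, l', fun v w => ?_, fun x => ?_⟩
  · rw [neg_apply, neg_apply, inner_neg_left, inner_neg_right, hskew v w, neg_neg]
  -- the parameter space and the orbit map at `x`
  set e : ℝ × ((EuclideanSpace ℝ (Fin 3) →L[ℝ] EuclideanSpace ℝ (Fin 3)) × ((EuclideanSpace ℝ (Fin 3) →L[ℝ] EuclideanSpace ℝ (Fin 3)) ×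
      EuclideanSpace ℝ (Fin 3))) := (1, (ContinuousLinearMap.id ℝ (EuclideanSpace ℝ (Fin 3)), (ContinuousLinearMap.id ℝ (EuclideanSpace ℝ (Fin 3)), 0))) with he
  set ξ : ℝ × ((EuclideanSpace ℝ (Fin 3) →L[ℝ] EuclideanSpace ℝ (Fin 3)) × ((EuclideanSpace ℝ (Fin 3) →L[ℝ] EuclideanSpace ℝ (Fin 3)) ×
      EuclideanSpace ℝ (Fin 3))) := (l', (Rd, (Rd', ad))) with hξ
  set F : ℝ × ((EuclideanSpace ℝ (Fin 3) →L[ℝ] EuclideanSpace ℝ (Fin 3)) × ((EuclideanSpace ℝ (Fin 3) →L[ℝ] EuclideanSpace ℝ (Fin 3)) ×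
      EuclideanSpace ℝ (Fin 3))) → EuclideanSpace ℝ (Fin 3) := fun q => q.1 • q.2.1 (m (q.1 • q.2.2.1 (x - q.2.2.2))) with hF
  have hFd : HasFDerivAt F (fderiv ℝ F e) e := (differentiableAt_orbitParam hm x e).hasFDerivAt
  -- the parameter sequence and its difference quotients
  set d : ℕ → ℝ × ((EuclideanSpace ℝ (Fin 3) →L[ℝ] EuclideanSpace ℝ (Fin 3)) × ((EuclideanSpace ℝ (Fin 3) →L[ℝ]
      EuclideanSpace ℝ (Fin 3)) × EuclideanSpace ℝ (Fin 3))) := fun n =>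
    (lam n - 1, ((C n - ContinuousLinearMap.id ℝ (EuclideanSpace ℝ (Fin 3))), ((C' n - ContinuousLinearMap.id ℝ (EuclideanSpace ℝ (Fin 3))), a n))) with hd
  have hcd : Tendsto (fun n => (τ n)⁻¹ • d n) atTop (𝓝 ξ) := by
    have : (fun n => (τ n)⁻¹ • d n) = fun n => ((τ n)⁻¹ * (lam n - 1), ((τ n)⁻¹ • (C n - ContinuousLinearMap.id ℝ (EuclideanSpace ℝ (Fin 3))),
        ((τ n)⁻¹ • (C' n - ContinuousLinearMap.id ℝ (EuclideanSpace ℝ (Fin 3))), (τ n)⁻¹ • a n))) := by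
      funext n; rfl
    rw [this, hξ]
    exact hl.prodMk_nhds (hC.prodMk_nhds (hC'.prodMk_nhds ha))
  have hd0 : Tendsto d atTop (𝓝 0) := tendsto_zero_of_rate (x := d) (L := ξ) hτ0 hcd hτ
  have hlimF := tendsto_smul_sub_of_hasFDerivAt hFd hd0 hcd
  -- identify `F (e + d n)` and `F e`
  have hFe : F e = m x := by
    simp only [hF, he, one_smul, ContinuousLinearMap.id_apply, sub_zero]
  have hFn : ∀ n, F (e + d n) = lam n • C n (m (lam n • C' n (x - a n))) := by
    intro n
    simp only [hF, he, hd, Prod.mk_add_mk, add_sub_cancel, zero_add]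
  simp only [hFe, hFn] at hlimF
  have hhx : h x = fderiv ℝ F e ξ := tendsto_nhds_unique (hh x) hlimF
  -- compute `fderiv F e ξ` along the straight path through the identity
  have hpath : HasDerivAt (fun t : ℝ => F (e + t • ξ)) (fderiv ℝ F e ξ) 0 := by
    have hγ : HasDerivAt (fun t : ℝ => e + t • ξ) ξ 0 := by
      have := ((hasDerivAt_id (0 : ℝ)).smul_const ξ).const_add e
      simpa using this
    have hγ0 : e + (0 : ℝ) • ξ = e := by
      rw [hξ, he]
      refine Prod.ext ?_ (Prod.ext ?_ (Prod.ext ?_ ?_))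
      · simp
      · ext v; simp
      · ext v; simp
      · simp
    have hFd0 : HasFDerivAt F (fderiv ℝ F e) (e + (0 : ℝ) • ξ) := by rw [hγ0]; exact hFd
    exact hFd0.comp_hasDerivAt (0 : ℝ) hγ
  -- the same path written for `hasDerivAt_movingOrbit`
  set lamp : ℝ → ℝ := fun t => 1 + t * l' with hlamp
  set ap : ℝ → EuclideanSpace ℝ (Fin 3) := fun t => t • ad with hap
  set Rc : ℝ → (EuclideanSpace ℝ (Fin 3) →L[ℝ] EuclideanSpace ℝ (Fin 3)) := fun t => ContinuousLinearMap.id ℝ (EuclideanSpace ℝ (Fin 3)) + t • Rd with hRc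
  set Rc' : ℝ → (EuclideanSpace ℝ (Fin 3) →L[ℝ] EuclideanSpace ℝ (Fin 3)) := fun t => ContinuousLinearMap.id ℝ (EuclideanSpace ℝ (Fin 3)) + t • Rd' with hRc'
  have hlam1 : HasDerivAt lamp l' 0 := by
    have := ((hasDerivAt_id (0 : ℝ)).mul_const l').const_add 1
    simpa [hlamp] using this
  have ha1 : HasDerivAt ap ad 0 := by
    have := (hasDerivAt_id (0 : ℝ)).smul_const ad
    simpa [hap] using this
  have hRc1 : HasDerivAt Rc Rd 0 := by
    have := ((hasDerivAt_id (0 : ℝ)).smul_const Rd).const_add (ContinuousLinearMap.id ℝ (EuclideanSpace ℝ (Fin 3)))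
    simpa [hRc] using this
  have hRc'1 : HasDerivAt Rc' Rd' 0 := by
    have := ((hasDerivAt_id (0 : ℝ)).smul_const Rd').const_add (ContinuousLinearMap.id ℝ (EuclideanSpace ℝ (Fin 3)))
    simpa [hRc'] using this
  have hy : lamp 0 • Rc' 0 (x - ap 0) = x := by simp [hlamp, hRc', hap]
  have hpath' := hasDerivAt_movingOrbit (lam := lamp) (a := ap) (Rc := Rc) (Rc' := Rc') x x hlam1 ha1 hRc1 hRc'1 hy
    (hm x)
  have hsame : (fun t : ℝ => F (e + t • ξ)) = fun σ => lamp σ • Rc σ (m (lamp σ • Rc' σ (x - ap σ))) := by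
    funext t
    simp only [hF, he, hξ, hlamp, hRc, hRc', hap, Prod.smul_mk, Prod.mk_add_mk, smul_eq_mul, mul_comm t l', zero_add]
  rw [hsame] at hpath
  have hval := hpath.unique hpath'
  rw [hhx, hval]
  simp only [hlamp, hRc, hRc', hap, zero_mul, add_zero, zero_smul, sub_zero, one_smul, add_apply, smul_apply,
    ContinuousLinearMap.id_apply, neg_apply, hneg, map_add, map_sub, map_neg, map_smul, smul_add]
  abel

end TangentCone

end RigidExit

end Summit.NavierStokesRegularity.NavierStokesRegularity.Theorems
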